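import Summits.ResolutionOfSingularities.ResolutionOfSingularities.Theorems.FrobeniusLadderFInjectiveMacaulayficationNewtonChartLemmaWeak
import Summits.ResolutionOfSingularities.ResolutionOfSingularities.Theorems.FrobeniusLadderFInjectiveMacaulayficationNewtonChartHon
import HarnessLib

/-!
# (W-ND)⁺ «TJURINA UPGRADE» (B): regular ⇒ FULL over the origin on refining unimodular charts, and the row engine's per-chart clause `hon'`, for WEAKLY non-degenerate `f`
# (crux `FInjectiveMacaulayfication` stmt-ResolutionOfSingularities-15315, chain w45a; seat res-L1-w45a-stub-3 g11, FINDING + OFFER STATUS 18:02Z; twins-by-callee-swap of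
# res-L1-w45a-stub-1's ✓ p651999 `NewtonChartLemmaRegular.{isRegularLocalRing_of_chart, fullCl_of_chart}` and ✓ p652509 `NewtonChartHon.hon_of_newtonNondegenerate`, with
# `hND : IsNewtonNondegenerate ↑f` replaced by `hWND : ∀ w > 0, IsWeaklyNondegenerateAlong w ↑f` and Ishii's lemma by its Tjurina version `ishii_lemma_4_4_24_weak` ((A)))

[OURS · L1 W4.5a] Support file (`--supports stmt-ResolutionOfSingularities-15315 --as helper`); def-free; UNCONDITIONAL; no named fact. NOT a statement of any manuscript.
AI-written (AI review is weaker than expert review).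

* ★★ `isRegularLocalRing_of_chart_weak`, ★★ `fullCl_of_chart_weak` — on a unimodular chart refining the dual Newton fan, at every `k`-point over the origin, the strict
  transform of a hypersurface WEAKLY non-degenerate along every positive weight is REGULAR, hence `FullCl p`;
* ★★ `hon_of_weaklyNondegenerate` — the `hon'` binder of `CICertificates.ciCertificates(_of_isPrime)` (`J := univ`, `r := 1`, `Fs := ![f]`, `gs c := ![g_c]`) for such `f`
  over `k = k̄` of characteristic `p` and a family of refining unimodular charts.
Proof texts = the originals byte-for-byte except the hypothesis and the callee names. In characteristic `p` this covers the census beds (`z² + x^a z + …` at `p = 2`,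
`z³ + …` at `p = 3`), whose lone vertex `z^p` is Jacobian-degenerate but Tjurina-harmless ((C) `…CensusBedsWND`).
[cite: IshiiSingularities2018, Lemma 4.4.24 (pp. 96–97)] [cite: Matsumura1987, Thm. 30.4] [cite: BoubakriGreuelMarkwig2010, §3 (p. 10)]
-/

-- single-problem summit: the doubled namespace component is forced
set_option linter.dupNamespace false

noncomputable section

open MvPolynomial

namespace Summit.ResolutionOfSingularities.ResolutionOfSingularities.Theorems.FInjectiveMacaulayfication.NewtonChartLemma

open Summit.ResolutionOfSingularities.ResolutionOfSingularities.Theorems.FInjectiveMacaulayfication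
open Literature.AlgebraicGeometry.Resolution Literature.AlgebraicGeometry.Resolution.BoubakriGreuelMarkwig SliceableCentre

variable {k : Type} [Field k] {m : ℕ}

/-! ## §1 Regular, hence FULL, over the origin -/

/-- ★★ **REGULARITY OF THE STRICT TRANSFORM OVER THE ORIGIN, TJURINA VERSION** (`ishii_lemma_4_4_24_weak` + Jacobian criterion): for `f` weakly non-degenerate along
every positive weight, `V` unimodular with `θ_V f = Y^e · g`, `g(0) ≠ 0`, a `k`-point `y` of the orbit `{yᵢ = 0 ⟺ i ∈ S}` over the origin, and `Q` the prime of `k[Y]/(g)` at `y`,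
the local ring `(k[Y]/(g))_Q` is REGULAR. (p651999 verbatim, callee swapped.) [cite: IshiiSingularities2018, Lemma 4.4.24 (pp. 96–97)] [cite: Matsumura1987, Thm. 30.4] -/
theorem isRegularLocalRing_of_chart_weak (f : MvPolynomial (Fin m) k)
    (hWND : ∀ w : Fin m → ℝ, (∀ i, 0 < w i) → IsWeaklyNondegenerateAlong w (f : MvPowerSeries (Fin m) k))
    (V : Matrix (Fin m) (Fin m) ℕ) (hV : IsUnit (V.map (Nat.cast : ℕ → ℤ)).det)
    (e : Fin m →₀ ℕ) (g : MvPolynomial (Fin m) k) (hθ : aeval (fun j : Fin m => ∏ i : Fin m, (X i : MvPolynomial (Fin m) k) ^ V i j) f = monomial e 1 * g)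
    (hg0 : constantCoeff g ≠ 0) (S : Finset (Fin m)) (hpos : ∀ j : Fin m, 0 < ∑ i ∈ S, V i j) (y : Fin m → k) (hy : ∀ i : Fin m, y i = 0 ↔ i ∈ S)
    (Q : Ideal (MvPolynomial (Fin m) k ⧸ Ideal.span {g})) [Q.IsPrime]
    (hQ : Q.comap (Ideal.Quotient.mk (Ideal.span {g})) = RingHom.ker (MvPolynomial.eval y)) :
    IsRegularLocalRing (Localization.AtPrime Q) := by
  have hgQ : g ∈ Q.comap (Ideal.Quotient.mk (Ideal.span {g})) := by
    rw [Ideal.mem_comap, Ideal.Quotient.eq_zero_iff_mem.mpr (Ideal.mem_span_singleton_self g)]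
    exact Q.zero_mem
  have hgy : MvPolynomial.eval y g = 0 := by
    rw [hQ] at hgQ
    exact (RingHom.mem_ker).mp hgQ
  obtain ⟨i, -, hi⟩ := ishii_lemma_4_4_24_weak f hWND V hV e g hθ hg0 S hpos y hy hgy
  refine HypersurfaceRegular.stub_hypersurfaceRegularOfPderiv k m g i Q ?_
  rw [hQ, RingHom.mem_ker]
  exact hi

/-- ★★ **… HENCE FULL** (Tjurina version): in characteristic `p`, at every such point the local ring of the strict transform is `FullCl p` — regular local rings are FULL
(`FTemkinClosedPoints.fullCl_of_isRegularLocalRing`). (p651999 verbatim, callee swapped.) [OURS · unconditional; cite: IshiiSingularities2018, Lemma 4.4.24; Matsumura1987, Thm. 30.4] -/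
theorem fullCl_of_chart_weak (p : ℕ) [Fact p.Prime] [CharP k p] (f : MvPolynomial (Fin m) k)
    (hWND : ∀ w : Fin m → ℝ, (∀ i, 0 < w i) → IsWeaklyNondegenerateAlong w (f : MvPowerSeries (Fin m) k))
    (V : Matrix (Fin m) (Fin m) ℕ) (hV : IsUnit (V.map (Nat.cast : ℕ → ℤ)).det)
    (e : Fin m →₀ ℕ) (g : MvPolynomial (Fin m) k) (hθ : aeval (fun j : Fin m => ∏ i : Fin m, (X i : MvPolynomial (Fin m) k) ^ V i j) f = monomial e 1 * g)
    (hg0 : constantCoeff g ≠ 0) (S : Finset (Fin m)) (hpos : ∀ j : Fin m, 0 < ∑ i ∈ S, V i j) (y : Fin m → k) (hy : ∀ i : Fin m, y i = 0 ↔ i ∈ S)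
    (Q : Ideal (MvPolynomial (Fin m) k ⧸ Ideal.span {g})) [Q.IsPrime]
    (hQ : Q.comap (Ideal.Quotient.mk (Ideal.span {g})) = RingHom.ker (MvPolynomial.eval y)) :
    FullCl p (Localization.AtPrime Q) := by
  haveI := isRegularLocalRing_of_chart_weak f hWND V hV e g hθ hg0 S hpos y hy Q hQ
  haveI : Nontrivial (MvPolynomial (Fin m) k ⧸ Ideal.span {g}) :=
    nontrivial_of_ne (1 : MvPolynomial (Fin m) k ⧸ Ideal.span {g}) 0 fun h10 =>
      Ideal.IsPrime.ne_top ‹_› ((Ideal.eq_top_iff_one Q).mpr (by rw [h10]; exact Q.zero_mem))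
  haveI : CharP (MvPolynomial (Fin m) k ⧸ Ideal.span {g}) p :=
    charP_of_injective_algebraMap (algebraMap k (MvPolynomial (Fin m) k ⧸ Ideal.span {g})).injective p
  haveI : CharP (Localization.AtPrime Q) p := DegreeZeroDescent.charP_localization_atPrime p Q
  exact FTemkinClosedPoints.fullCl_of_isRegularLocalRing p _

/-! ## §2 The engine's per-chart clause from WEAK non-degeneracy -/

set_option maxHeartbeats 800000 in
-- the clause binder block is large; one Nullstellensatz point, one transport along `quotEquivOfEq`, one `fullCl_of_chart_weak`
/-- ★★ **`hon'` FOR THE WEAKLY NON-DEGENERATE CLASS.** `k` algebraically closed of characteristic `p`; `f ∈ k[X]` weakly non-degenerate along every positive weight;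
unimodular charts `V_c` refining the dual Newton fan (`θ_{V_c} f = Y^{d_c}·g_c`, `g_c(0) ≠ 0`). Then for every chart `c` and every MAXIMAL ideal `Q'` of `k[Y]/(g_c)` over the
origin: (i) each variable `Y_i ∈ Q'` is a non-zero-divisor modulo `g_c` locally, and (ii) `(k[Y]/(g_c))_{Q'}` carries the CM + Frobenius-closed clause (it is REGULAR). This is
the binder `hon'` of `CICertificates.ciCertificates` / `ciCertificates_of_isPrime` with `J := univ`, `r := 1`, `Fs := ![f]`, `gs c := ![g_c]`, VERBATIM. (p652509 verbatim,
callee swapped.) [cite: IshiiSingularities2018, Lemma 4.4.24] -/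
theorem hon_of_weaklyNondegenerate (p : ℕ) [Fact p.Prime] [IsAlgClosed k] [CharP k p] (f : MvPolynomial (Fin m) k)
    (hWND : ∀ w : Fin m → ℝ, (∀ i, 0 < w i) → IsWeaklyNondegenerateAlong w (f : MvPowerSeries (Fin m) k)) (t : ℕ) (V : Fin t → Matrix (Fin m) (Fin m) ℕ)
    (hV : ∀ c, IsUnit ((V c).map (Nat.cast : ℕ → ℤ)).det) (g : Fin t → MvPolynomial (Fin m) k) (d : Fin t → (Fin m →₀ ℕ))
    (hθ : ∀ c, aeval (fun j : Fin m => ∏ i : Fin m, (X i : MvPolynomial (Fin m) k) ^ V c i j) f = monomial (d c) 1 * g c)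
    (hg0 : ∀ c, constantCoeff (g c) ≠ 0) :
    ∀ (c : Fin t) (Q' : Ideal (MvPolynomial (Fin m) k ⧸ Ideal.span (Set.range (![g c] : Fin 1 → MvPolynomial (Fin m) k)))) [Q'.IsMaximal],
      (∀ j ∈ (Finset.univ : Finset (Fin m)), Ideal.Quotient.mk (Ideal.span (Set.range (![g c] : Fin 1 → MvPolynomial (Fin m) k)))
        (aeval (fun j : Fin m => ∏ i : Fin m, (X i : MvPolynomial (Fin m) k) ^ V c i j) (X j : MvPolynomial (Fin m) k)) ∈ Q') →
        (∀ i : Fin m, (X i : MvPolynomial (Fin m) k) ∈ Q'.comap (Ideal.Quotient.mk (Ideal.span (Set.range (![g c] : Fin 1 → MvPolynomial (Fin m) k)))) →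
          IsSMulRegular (Localization.AtPrime (Q'.comap (Ideal.Quotient.mk (Ideal.span (Set.range (![g c] : Fin 1 → MvPolynomial (Fin m) k))))) ⧸
              (Ideal.span (Set.range (![g c] : Fin 1 → MvPolynomial (Fin m) k))).map (algebraMap (MvPolynomial (Fin m) k)
                (Localization.AtPrime (Q'.comap (Ideal.Quotient.mk (Ideal.span (Set.range (![g c] : Fin 1 → MvPolynomial (Fin m) k))))))))
            (algebraMap (MvPolynomial (Fin m) k)
              (Localization.AtPrime (Q'.comap (Ideal.Quotient.mk (Ideal.span (Set.range (![g c] : Fin 1 → MvPolynomial (Fin m) k)))))) (X i))) ∧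
        ∀ dd : ℕ, ringKrullDim (Localization.AtPrime Q') = dd → ∀ s : Fin dd → Localization.AtPrime Q',
          (Ideal.span (Set.range s)).radical.IsMaximal →
            RingTheory.Sequence.IsWeaklyRegular (Localization.AtPrime Q') (List.ofFn s) ∧
            ∀ y : Localization.AtPrime Q', (∃ e : ℕ, y ^ p ^ e ∈ Ideal.span
              ((fun z : Localization.AtPrime Q' => z ^ p ^ e) ''
                (Ideal.span (Set.range s) : Set (Localization.AtPrime Q')))) → y ∈ Ideal.span (Set.range s) := by
  classical
  intro c Q' _ hover
  have hI : Ideal.span {g c} = Ideal.span (Set.range (![g c] : Fin 1 → MvPolynomial (Fin m) k)) := (span_range_vec_one (g c)).symm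
  -- the Nullstellensatz point `y` of `Q'` and its zero pattern `S`
  obtain ⟨y, hy⟩ := exists_point_of_isMaximal (Ideal.span (Set.range (![g c] : Fin 1 → MvPolynomial (Fin m) k))) Q'
  set S : Finset (Fin m) := Finset.univ.filter fun i => y i = 0 with hS
  have hyS : ∀ i, y i = 0 ↔ i ∈ S := fun i => by simp [hS]
  -- the orbit of `y` lies over the origin
  have hpos : ∀ j : Fin m, 0 < ∑ i ∈ S, V c i j := by
    refine sum_row_pos_of_theta_X_mem (V c) y S hyS (fun j => ?_)
    have h1 : aeval (fun j : Fin m => ∏ i : Fin m, (X i : MvPolynomial (Fin m) k) ^ V c i j) (X j : MvPolynomial (Fin m) k) ∈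
        Q'.comap (Ideal.Quotient.mk (Ideal.span (Set.range (![g c] : Fin 1 → MvPolynomial (Fin m) k)))) := hover j (Finset.mem_univ j)
    rw [hy, RingHom.mem_ker, aeval_X] at h1
    exact h1
  refine ⟨fun i _ => ?_, ?_⟩
  · -- (i) `Y_i` is a non-zero-divisor modulo `g_c`, locally
    exact KLocCell.isSMulRegular_localization_quotient_of_prime_not_dvd _ (MvPolynomial.X_prime (i := i))
      (not_X_dvd_of_constantCoeff_ne_zero (g c) (hg0 c) i) _ (span_range_vec_one (g c))
  · -- (ii) the clause: transport `fullCl_of_chart` along `k[Y]/(g_c) ≃ k[Y]/(Set.range ![g_c])`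
    let e : (MvPolynomial (Fin m) k ⧸ Ideal.span {g c}) ≃+* (MvPolynomial (Fin m) k ⧸ Ideal.span (Set.range (![g c] : Fin 1 → MvPolynomial (Fin m) k))) :=
      Ideal.quotEquivOfEq hI
    haveI : (Q'.comap e.toRingHom).IsPrime := Ideal.comap_isPrime _ _
    have hQ : (Q'.comap e.toRingHom).comap (Ideal.Quotient.mk (Ideal.span {g c})) = RingHom.ker (MvPolynomial.eval y) := by
      rw [← hy, Ideal.comap_comap]
      congr 1
    have hfull : FullCl p (Localization.AtPrime (Q'.comap e.toRingHom)) :=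
      fullCl_of_chart_weak p f hWND (V c) (hV c) (d c) (g c) (hθ c) (hg0 c) S hpos y hyS _ hQ
    exact (LocalBlowupBadFibreFromCharts.fullCl_localization_of_ringEquiv p e _ Q' rfl hfull).2

end Summit.ResolutionOfSingularities.ResolutionOfSingularities.Theorems.FInjectiveMacaulayfication.NewtonChartLemma

end
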